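import Summits.HodgeConjecture.HodgeConjecture.Theorems.F0P3cStCharTSQuadReparam       -- ★ p851585 (this seat) «QUAD-REPARAM★» `exists_keysParam_of_quadChar`; brings ★ UniqPar (`conjInvChar_normSqInv`), ★ Ps2Kind3 (`isConstituentOf_iff_of_eq`, K1w `isConstituentOf_iff_weyl`)
import Literature.NumberTheory.Rogawski1990.CMLocalAPacketMembers                      -- ★ `KeysCaseTwoLabels` (the Keys-labelled pair predicate read by ★ XI-SURJ ∕ KEYS-PAIRS (f))
import Literature.NumberTheory.Automorphic.CMPrincipalSeriesOpenCellSection            -- ★ N1 `exists_cmPrincipalSeries_cmTorusCharPair_toFun_one_eq_zero_and_mk_ne_zero` (`i_G(χ) ≠ 0`)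
import Literature.NumberTheory.Rogawski1990.Ch12Sec5Defs                               -- ★ `Ch12Sec5.EllipticData` (fields `ldsPackets stG detG pi2 piN`)
import Summits.HodgeConjecture.HodgeConjecture.Theorems.F0P3cStCharTSEllClass           -- ★ (LH6-p03 g4) «ELL-CLASS ⟸ RED-JH★» `ellipticClassification_of_redJH` (the consumer; §3 composes)
import HarnessLib

/-!
# F0 · P3c · line LH6 «StCharTS» — datum road «RED-JH ⟸ KEYS-RED★»: Rogawski's §12.2 LIST «if `i_G(χ)` is reducible, `JH(i_G(χ))` is an l.d.s. packet, or
# `{St_G(ψ), ψ∘det_G}`, or `{π²(ξ), πⁿ(ξ)}`» AT THE DATUM, from Keys' reducibility theorem (hypothesis `hKeysRed`), the datum's LABEL FIELD EQUATIONS, and «LDS-TWO»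
# [Rogawski1990 §12.2 pp. 172–174; Keys1984 §7 Thm. p. 126]

Cell `pub/hodgecm-mathlib`, crux H413 = `stmt-HodgeConjecture-24833` (`--supports` lane, helper), route HCCMUnconditional; seat LH6-p04 (g6); the stage-B ASSEMBLY of
LH6-p03 (g4)'s «ELL-CLASS ⟸ RED-JH★» (★ `F0P3cStCharTSEllClass`, whose hypothesis `hRedJH` :62–:71 is this file's CONCLUSION token for token), named to this seat
2026-09-02T13:10:59Z (map owner LH6-p01 (g4) 13:16:28Z: JUNCTION «`hRedJH` ⟸ {`hKeysRed`, `hLdsTwo`}»).  THEOREMS ONLY, sorry-free, no definition ∕ instance ∕ notation ∕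
named fact; the §12.5 datum `𝔇` is a BINDER with generic `H` (road rule §2.1: every field enters through an `=`∕`↔`∕label hypothesis dischargeable at the witness).
HONEST LABEL: HC_CM is proved only modulo the 7 printed citations (2 remaining: hLiu418 = stmt-HodgeConjecture-24832, h413 = stmt-HodgeConjecture-24833) until rung 0
closes; count-neutral (closes no organ; no leaf edition implied — at the junction the named conjunct input `hEllClass` becomes {`hKeysRed`, `hLdsTwo`}, both print-cited
model-level statements, plus field hypotheses).

THE INPUTS (all hypothesis texts are other ★ files' binders VERBATIM, so the junction ∕ RUNG0 discharges them by name):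
* `hKeysRed` — Keys' theorem, ⇒-half, in the PAIR currency [§12.2 p. 173 ll. 8–12; Keys1984 §7]: ★ `F0P3cStCharTSUniqPar` :297–:305 (LH6-p02 (g5)) token for token
  («reducible (`∃ N, ⊥ ≠ N ≠ ⊤`) ⇒ (1) `χ₁ = ‖·‖^{±1}` ∨ (2) `χ₁ = η‖·‖^{±1/2}`, `η|F* = ω` ∨ (3) `χ₁ ≠ 1`, `χ₁|F* = 1`»);
* `hStJH` — the Steinberg LABEL clause read at `ψ₀ ∈ Hom(E¹_v, ℂ*)`: «for continuous `ψ₀` there is a continuous `ψ : Z(G) →* ℂˣ` with `JH(i_G(‖·‖⁻¹, ψ₀)) = {𝔇.stG ψ,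
  𝔇.detG ψ}`» = the conclusion of ★ `F0P3cStCharTSStJH.stJH_of_fields` (F0P2-p06 (g17), p851573) at `stG detG := 𝔇.stG 𝔇.detG` minus its `ψ ∘ ι = ψ₀` conjunct
  (RUNG0: `fun ψ₀ h => (stJH_of_fields L v hns ι hιc hι _ _ hJH ψ₀ h).imp fun ψ hψ => ⟨hψ.1, hψ.2.2⟩` after `subst`);
* `hKeysJH` — the Keys LABEL clause: «for continuous `η₁ η₂` there is a continuous `ξ′ : H →* ℂˣ` with `KeysCaseTwoLabels L v μ_v η₁ η₂ (𝔇.pi2 ξ′) (𝔇.piN ξ′)`» = clause (f)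
  of ★ `F0P3cStCharTSXiSurj.exists_keysFields_Hv_pairs` (LH6-p03 (g4)) at `pi2 piN := 𝔇.pi2 𝔇.piN`, token for token; `μ_v` = the fixed continuous `ω`-type character
  (RUNG0: `μ.semilocalComponent L v`, ★ `isQuadraticCharExtension_semilocalComponent_of_baseChange_eq`);
* `hLdsF` — the l.d.s. FIELD EQUATION of ★ S5 ∕ ★ DATUM-JUNCTION (`P ∈ ldsPackets ↔ P.card = 2 ∧ ∃ χ₁ χ₂ …`), verbatim (only ⇐ is used);
* `hLdsTwo` — «LDS-TWO», NAMED INPUT [§12.2 (3) p. 174 «the two elements of `JH(i_B(θ̃))`»; Keys1984 §7 Thm. (1)]: the unitary `i_G(χ₁, χ₂)` with `χ₁|F* = 1`, `χ₁ ≠ 1`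
  has EXACTLY TWO distinct constituents (census 13:20Z: not in ★ — no `R`-group ∕ intertwining-operator theory in the tree; `wχ = χ` here, so exponents cannot separate them).
THE PROOF is bookkeeping: `¬ IsIrreducible` ⇒ `∃ N, ⊥ ≠ N ≠ ⊤` (`i_G(χ) ≠ 0` by ★ N1's open-cell vector); `hKeysRed` trichotomy; case (1) `χ₁ = ‖·‖⁻¹`: `hStJH` at `ψ₀ = χ₂`, and
`χ₁ = ‖·‖`: the same through ★ K1w since `w(‖·‖⁻¹) = ‖·‖` (★ `conjInvChar_normSqInv`); case (2) `χ₁ = η‖·‖^{±1/2}`: ★ «QUAD-REPARAM★» writes the parameter as `χ_ξ(μ_v, η₁, χ₂)`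
(up to `w`), `hKeysJH` names the pair; case (3): `hLdsTwo` gives the two-element JH-set `P`, `hLdsF` (⇐) puts it in `ldsPackets`.

## References
* [Rogawski1990] J. D. Rogawski, *Automorphic Representations of Unitary Groups in Three Variables*, Ann. of Math. Stud. 123 (1990): §12.1 pp. 171–172; §12.2 pp. 172–174
  (Keys' three cases p. 173 ll. 8–12; «if `i_G(χ)` is reducible, it contains exactly two irreducible constituents»; list (1)–(6); (3) p. 174 l.d.s. packets); §12.6 p. 187
  (the classification sentence consumed by ★ ELL-CLASS).
* [Keys1984] D. Keys, *Principal series representations of special unitary groups over local fields*, Compositio Math. 51 (1984), §7 Thm. p. 126.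
-/

set_option autoImplicit false
-- the mandated namespace has the single-problem summit's repeated segment (`HodgeConjecture.HodgeConjecture`)
set_option linter.dupNamespace false

noncomputable section

open NumberField IsDedekindDomain
open scoped Matrix

open Literature.NumberTheory.Rogawski1990 Literature.NumberTheory.Automorphic Literature.NumberTheory.Automorphic.UnitaryGroup

namespace Summit.HodgeConjecture.HodgeConjecture.Cruxes.H413.F0P3cStCharTSRedJH

variable (L : Type) [Field L] [NumberField L] [IsCMField L] (v : HeightOneSpectrum (𝓞 ↥(maximalRealSubfield L)))

/-! ## §1 `i_G(χ₁, χ₂)` is a non-zero representation: `¬ irreducible ⇒ ∃ ⊥ ≠ N ≠ ⊤` -/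

set_option synthInstance.maxHeartbeats 400000 in
set_option maxHeartbeats 4000000 in
-- statement∕proof-heavy: the `SmoothInd` carrier of `cmPrincipalSeries` (class of ★ UNIQ-PAR §2)
/-- **`i_G(χ₁, χ₂)` not irreducible ⇒ it has a `G`-stable `⊥ ≠ N ≠ ⊤`** (continuous `χ₁, χ₂`): the space is non-zero (★ N1 open-cell vector
`exists_cmPrincipalSeries_cmTorusCharPair_toFun_one_eq_zero_and_mk_ne_zero`), so `Subrepresentation` is nontrivial and «not a simple order» produces the witness — the
«reducible» currency of ★ `KeysCaseTwoReducible` ∕ `hKeysRed`. [cite: Rogawski1990, §12.2 p. 173] [cite: Casselman1995, Lemma 7.1.1 (a)] -/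
theorem exists_ne_bot_ne_top_of_not_isIrreducible
    (χ₁ : (LocalRing L v)ˣ →* ℂˣ) (χ₂ : ↥(normOneUnits (conjLocal L (IsCMField.complexConj L) v)) →* ℂˣ)
    (h1 : Continuous fun x => ((χ₁ x : ℂˣ) : ℂ)) (h2 : Continuous fun x => ((χ₂ x : ℂˣ) : ℂ))
    (hred : ¬ (cmPrincipalSeries L 3 v (cmTorusCharPair L v χ₁ χ₂)).IsIrreducible) :
    ∃ N : Subrepresentation (cmPrincipalSeries L 3 v (cmTorusCharPair L v χ₁ χ₂)), N ≠ ⊥ ∧ N ≠ ⊤ := by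
  haveI := locallyCompactSpace_cmBorelU L 3 v
  by_contra h
  push Not at h
  obtain ⟨Φ, -, hΦ⟩ := exists_cmPrincipalSeries_cmTorusCharPair_toFun_one_eq_zero_and_mk_ne_zero L v χ₁ χ₂ h1 h2
  have hΦ0 : Φ ≠ 0 := fun h0 => hΦ (by rw [h0, map_zero])
  haveI : Nontrivial (Subrepresentation (cmPrincipalSeries L 3 v (cmTorusCharPair L v χ₁ χ₂))) := ⟨⟨⊥, ⊤, fun hbt => by
    have h' := congrArg Subrepresentation.toSubmodule hbt
    haveI : Nontrivial _ := ⟨⟨Φ, 0, hΦ0⟩⟩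
    exact bot_ne_top h'⟩⟩
  exact hred ⟨fun N => (eq_or_ne N ⊥).elim Or.inl fun hb => Or.inr (h N hb)⟩

/-! ## §2 THE ASSEMBLY — `hRedJH` of ★ ELL-CLASS from `hKeysRed`, the label clauses, the l.d.s. field equation and «LDS-TWO» -/

set_option synthInstance.maxHeartbeats 400000 in
set_option maxHeartbeats 16000000 in
-- statement∕proof-heavy: nine `IsConstituentOf (cmPrincipalSeries …)` shapes, the Keys hypothesis and the five-way case split (class of ★ UNIQ-PAR §3 `ldsShape_…`, 16M there)
/-- **«RED-JH ⟸ KEYS-RED★»: Rogawski's §12.2 list at the datum** — for every continuous pair `(χ₁, χ₂)` with `i_G(χ₁, χ₂)` NOT irreducible, `JH(i_G(χ₁, χ₂))` is an l.d.s.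
packet `P ∈ 𝔇.ldsPackets`, or `{𝔇.stG ψ, 𝔇.detG ψ}` for a continuous `ψ : Z(G) →* ℂˣ`, or `{𝔇.pi2 ξ′, 𝔇.piN ξ′}` for a continuous `ξ′ : H →* ℂˣ` — the hypothesis `hRedJH` of ★
`F0P3cStCharTSEllClass.ellipticClassification_of_redJH` TOKEN FOR TOKEN — from Keys' reducibility theorem `hKeysRed` (★ UNIQ-PAR's binder verbatim), the Steinberg and
Keys LABEL clauses `hStJH` ∕ `hKeysJH` (★ ST-JH ∕ ★ KEYS-PAIRS (f) at `𝔇.stG 𝔇.detG` ∕ `𝔇.pi2 𝔇.piN`), the l.d.s. field equation `hLdsF` (★ S5) and the named input «LDS-TWO»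
`hLdsTwo`.  See the module docstring. [cite: Rogawski1990, §12.2 pp. 172–174; §12.1 pp. 171–172] [cite: Keys1984, §7 Thm. p. 126] -/
theorem redJH_of_keysRed (hns : ∀ w : PlacesOver L v, IsCMField.complexConj L • w.1 = w.1)
    [MeasurableSpace (Gqs L v)] [∀ γ : Gqs L v, MeasurableSpace (Gqs L v ⧸ Subgroup.centralizer ({γ} : Set (Gqs L v)))]
    [MeasurableSpace (Gqs L v ⧸ Subgroup.center (Gqs L v))]
    {H : Type} [Group H] [TopologicalSpace H] [IsTopologicalGroup H] [MeasurableSpace H]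
    (𝔇 : Ch12Sec5.EllipticData (Gqs L v) H)
    -- ══ the fixed `ω`-type character `μ_v` of §4.8 (RUNG0: the local component of the Hecke character `μ`) ══
    (μv : (LocalRing L v)ˣ →* ℂˣ) (hμv : IsQuadraticCharExtension (conjLocal L (IsCMField.complexConj L) v) μv) (hμvc : Continuous fun x => ((μv x : ℂˣ) : ℂ))
    -- ══ Keys' reducibility theorem, ⇒-half (★ UNIQ-PAR :297–:305 verbatim) [§12.2 p. 173 ll. 8–12; Keys1984 §7] ══
    (hKeysRed : ∀ (χ₁ : (UnitaryGroup.LocalRing L v)ˣ →* ℂˣ) (χ₂ : ↥(normOneUnits (conjLocal L (IsCMField.complexConj L) v)) →* ℂˣ),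
      Continuous (fun x => ((χ₁ x : ℂˣ) : ℂ)) → Continuous (fun x => ((χ₂ x : ℂˣ) : ℂ)) →
      (∃ N : Subrepresentation (UnitaryGroup.cmPrincipalSeries L 3 v (UnitaryGroup.cmTorusCharPair L v χ₁ χ₂)), N ≠ ⊥ ∧ N ≠ ⊤) →
      (χ₁ = halfModulusChar (UnitaryGroup.LocalRing L v) * halfModulusChar (UnitaryGroup.LocalRing L v) ∨
          χ₁ = (halfModulusChar (UnitaryGroup.LocalRing L v) * halfModulusChar (UnitaryGroup.LocalRing L v))⁻¹) ∨
      (∃ η : (UnitaryGroup.LocalRing L v)ˣ →* ℂˣ, IsQuadraticCharExtension (conjLocal L (IsCMField.complexConj L) v) η ∧ Continuous (fun x => ((η x : ℂˣ) : ℂ)) ∧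
          (χ₁ = η * halfModulusChar (UnitaryGroup.LocalRing L v) ∨ χ₁ = η * (halfModulusChar (UnitaryGroup.LocalRing L v))⁻¹)) ∨
      (χ₁ ≠ 1 ∧ ∀ a : (UnitaryGroup.LocalRing L v)ˣ, (conjLocal L (IsCMField.complexConj L) v) (a : UnitaryGroup.LocalRing L v) = a → χ₁ a = 1))
    -- ══ the Steinberg label clause at `ψ₀ ∈ Hom(E¹_v, ℂ*)` (★ ST-JH `stJH_of_fields` at `𝔇.stG 𝔇.detG`) ══
    (hStJH : ∀ ψ₀ : ↥(normOneUnits (conjLocal L (IsCMField.complexConj L) v)) →* ℂˣ, Continuous (fun x => ((ψ₀ x : ℂˣ) : ℂ)) →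
      ∃ ψ : ↥(Subgroup.center (Gqs L v)) →* ℂˣ, Continuous ψ ∧
        ∀ c : IrrClass (Gqs L v),
          c.IsConstituentOf (UnitaryGroup.cmPrincipalSeries L 3 v
            (UnitaryGroup.cmTorusCharPair L v (halfModulusChar (UnitaryGroup.LocalRing L v) * halfModulusChar (UnitaryGroup.LocalRing L v))⁻¹ ψ₀)) ↔
            (c = 𝔇.stG ψ ∨ c = 𝔇.detG ψ))
    -- ══ the Keys label clause (★ KEYS-PAIRS (f) at `𝔇.pi2 𝔇.piN`) ══
    (hKeysJH : ∀ (η₁ η₂ : ↥(normOneUnits (conjLocal L (IsCMField.complexConj L) v)) →* ℂˣ),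
      Continuous (fun x => ((η₁ x : ℂˣ) : ℂ)) → Continuous (fun x => ((η₂ x : ℂˣ) : ℂ)) →
      ∃ ξ' : H →* ℂˣ, Continuous ξ' ∧ KeysCaseTwoLabels L v μv η₁ η₂ (𝔇.pi2 ξ') (𝔇.piN ξ'))
    -- ══ the l.d.s. field equation (★ S5 ∕ ★ DATUM-JUNCTION `hLdsF` verbatim) ══
    (hLdsF : ∀ P : Finset (IrrClass (Gqs L v)), P ∈ 𝔇.ldsPackets ↔ (P.card = 2 ∧ ∃ (χ₁ : (UnitaryGroup.LocalRing L v)ˣ →* ℂˣ) (χ₂ : ↥(normOneUnits (conjLocal L (IsCMField.complexConj L) v)) →* ℂˣ), Continuous (fun x => ((χ₁ x : ℂˣ) : ℂ)) ∧ Continuous (fun x => ((χ₂ x : ℂˣ) : ℂ)) ∧ (∀ a : (UnitaryGroup.LocalRing L v)ˣ, (conjLocal L (IsCMField.complexConj L) v) (a : UnitaryGroup.LocalRing L v) = a → χ₁ a = 1) ∧ χ₁ ≠ 1 ∧ ∀ c : IrrClass (Gqs L v), c ∈ P ↔ c.IsConstituentOf (UnitaryGroup.cmPrincipalSeries L 3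 v (UnitaryGroup.cmTorusCharPair L v χ₁ χ₂))))
    -- ══ «LDS-TWO» (NAMED INPUT) [§12.2 (3) p. 174; Keys1984 §7 Thm. (1)] ══
    (hLdsTwo : ∀ (χ₁ : (UnitaryGroup.LocalRing L v)ˣ →* ℂˣ) (χ₂ : ↥(normOneUnits (conjLocal L (IsCMField.complexConj L) v)) →* ℂˣ),
      Continuous (fun x => ((χ₁ x : ℂˣ) : ℂ)) → Continuous (fun x => ((χ₂ x : ℂˣ) : ℂ)) →
      (∀ a : (UnitaryGroup.LocalRing L v)ˣ, (conjLocal L (IsCMField.complexConj L) v) (a : UnitaryGroup.LocalRing L v) = a → χ₁ a = 1) → χ₁ ≠ 1 →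
      ∃ P : Finset (IrrClass (Gqs L v)), P.card = 2 ∧
        ∀ c : IrrClass (Gqs L v), c ∈ P ↔ c.IsConstituentOf (UnitaryGroup.cmPrincipalSeries L 3 v (UnitaryGroup.cmTorusCharPair L v χ₁ χ₂))) :
    ∀ (χ₁ : (UnitaryGroup.LocalRing L v)ˣ →* ℂˣ) (χ₂ : ↥(normOneUnits (conjLocal L (IsCMField.complexConj L) v)) →* ℂˣ),
      Continuous (fun x => ((χ₁ x : ℂˣ) : ℂ)) → Continuous (fun x => ((χ₂ x : ℂˣ) : ℂ)) →
      ¬ (UnitaryGroup.cmPrincipalSeries L 3 v (UnitaryGroup.cmTorusCharPair L v χ₁ χ₂)).IsIrreducible →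
      (∃ P ∈ 𝔇.ldsPackets, ∀ c : IrrClass (Gqs L v),
          c.IsConstituentOf (UnitaryGroup.cmPrincipalSeries L 3 v (UnitaryGroup.cmTorusCharPair L v χ₁ χ₂)) ↔ c ∈ P) ∨
      (∃ ψ : ↥(Subgroup.center (Gqs L v)) →* ℂˣ, Continuous ψ ∧ ∀ c : IrrClass (Gqs L v),
          c.IsConstituentOf (UnitaryGroup.cmPrincipalSeries L 3 v (UnitaryGroup.cmTorusCharPair L v χ₁ χ₂)) ↔ (c = 𝔇.stG ψ ∨ c = 𝔇.detG ψ)) ∨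
      (∃ ξ' : H →* ℂˣ, Continuous ξ' ∧ ∀ c : IrrClass (Gqs L v),
          c.IsConstituentOf (UnitaryGroup.cmPrincipalSeries L 3 v (UnitaryGroup.cmTorusCharPair L v χ₁ χ₂)) ↔ (c = 𝔇.pi2 ξ' ∨ c = 𝔇.piN ξ')) := by
  intro χ₁ χ₂ h1 h2 hred
  have hN := exists_ne_bot_ne_top_of_not_isIrreducible L v χ₁ χ₂ h1 h2 hred
  rcases hKeysRed χ₁ χ₂ h1 h2 hN with (hSt | hSt) | ⟨η, hη, hηc, hK | hK⟩ | ⟨hne1, hfix⟩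
  · -- case (1), `χ₁ = ‖·‖ = w(‖·‖⁻¹)`: the Steinberg labels through ★ K1w
    subst hSt
    obtain ⟨ψ, hψc, hjh⟩ := hStJH χ₂ h2
    refine Or.inr (Or.inl ⟨ψ, hψc, fun c => ?_⟩)
    have hw : cmTorusCharPair L v (halfModulusChar (LocalRing L v) * halfModulusChar (LocalRing L v)) χ₂ =
        cmTorusCharPair L v (conjInvChar (conjLocal L (IsCMField.complexConj L) v)
          (halfModulusChar (LocalRing L v) * halfModulusChar (LocalRing L v))⁻¹) χ₂ := by
      rw [F0P3cStCharTSUniqPar.conjInvChar_normSqInv L v]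
    rw [F0P3cStCharTSPs2Kind3.isConstituentOf_iff_of_eq L v hw c,
      ← F0P3cStCharTSPs2Kind3.isConstituentOf_iff_weyl L v hns (halfModulusChar (LocalRing L v) * halfModulusChar (LocalRing L v))⁻¹ χ₂ c]
    exact hjh c
  · -- case (1), `χ₁ = ‖·‖⁻¹`: the Steinberg labels directly
    subst hSt
    obtain ⟨ψ, hψc, hjh⟩ := hStJH χ₂ h2
    exact Or.inr (Or.inl ⟨ψ, hψc, hjh⟩)
  · -- case (2), `χ₁ = η‖·‖^{1/2}`: reparametrise as `χ_ξ(μ_v, η₁, χ₂)` (★ QUAD-REPARAM) and read the Keys labels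
    subst hK
    obtain ⟨η₁, hη₁c, hplus, -⟩ := F0P3cStCharTSQuadReparam.exists_keysParam_of_quadChar L v hns μv hμv hμvc η hη hηc χ₂
    obtain ⟨ξ', hξ'c, -, hjh⟩ := hKeysJH η₁ χ₂ hη₁c h2
    exact Or.inr (Or.inr ⟨ξ', hξ'c, fun c => (hplus c).trans ((hjh c).trans or_comm)⟩)
  · -- case (2), `χ₁ = η‖·‖^{-1/2}`: the Weyl-conjugate parameter, same labels
    subst hK
    obtain ⟨η₁, hη₁c, -, hminus⟩ := F0P3cStCharTSQuadReparam.exists_keysParam_of_quadChar L v hns μv hμv hμvc η hη hηc χ₂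
    obtain ⟨ξ', hξ'c, -, hjh⟩ := hKeysJH η₁ χ₂ hη₁c h2
    exact Or.inr (Or.inr ⟨ξ', hξ'c, fun c => (hminus c).trans ((hjh c).trans or_comm)⟩)
  · -- case (3), `χ₁ ≠ 1`, `χ₁|F* = 1`: «LDS-TWO» gives the two-element JH-set, the field equation (⇐) makes it an l.d.s. packet
    obtain ⟨P, hcard, hmem⟩ := hLdsTwo χ₁ χ₂ h1 h2 hfix hne1
    exact Or.inl ⟨P, (hLdsF P).2 ⟨hcard, χ₁, χ₂, h1, h2, hfix, hne1, hmem⟩, fun c => (hmem c).symm⟩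

/-! ## §3 Composition with ★ ELL-CLASS: the carpet `EllipticClassification` from `hKeysRed`, the label clauses, the vanishing clause and «LDS-TWO» -/

set_option synthInstance.maxHeartbeats 400000 in
set_option maxHeartbeats 16000000 in
-- statement-heavy (as §2, plus the ★ ELL-CLASS binders)
/-- **The carpet ★ `Ch12Sec6.EllipticClassification 𝔇` («elliptic ⇒ supercuspidal, or one of the three kinds of pairs», [§12.6 p. 187]) at the datum**, with ★ ELL-CLASS's
named input `hRedJH` DISCHARGED by §2: from the vanishing clause `hVan` (★ PS-VANISH (V2)), (LDS2) `hLds2`, Keys' theorem `hKeysRed`, the label clauses `hStJH` ∕ `hKeysJH`, the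
l.d.s. field equation `hLdsF` and «LDS-TWO» `hLdsTwo` — one term: ★ `ellipticClassification_of_redJH … hVan hLds2 (redJH_of_keysRed …)`.
[cite: Rogawski1990, §12.6 p. 187; §12.2 pp. 172–174] [cite: Keys1984, §7 Thm. p. 126] -/
theorem ellipticClassification_of_keysRed (hns : ∀ w : PlacesOver L v, IsCMField.complexConj L • w.1 = w.1)
    [MeasurableSpace (Gqs L v)] [∀ γ : Gqs L v, MeasurableSpace (Gqs L v ⧸ Subgroup.centralizer ({γ} : Set (Gqs L v)))]
    [MeasurableSpace (Gqs L v ⧸ Subgroup.center (Gqs L v))]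
    {H : Type} [Group H] [TopologicalSpace H] [IsTopologicalGroup H] [MeasurableSpace H]
    (𝔇 : Ch12Sec5.EllipticData (Gqs L v) H)
    (μv : (LocalRing L v)ˣ →* ℂˣ) (hμv : IsQuadraticCharExtension (conjLocal L (IsCMField.complexConj L) v) μv) (hμvc : Continuous fun x => ((μv x : ℂˣ) : ℂ))
    -- ══ ★ ELL-CLASS's other two inputs, verbatim ══
    (hVan : ∀ (π : IrrClass (Gqs L v)) (χ₁ : (UnitaryGroup.LocalRing L v)ˣ →* ℂˣ) (χ₂ : ↥(normOneUnits (conjLocal L (IsCMField.complexConj L) v)) →* ℂˣ),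
      Continuous (fun x => ((χ₁ x : ℂˣ) : ℂ)) → Continuous (fun x => ((χ₂ x : ℂˣ) : ℂ)) →
      (UnitaryGroup.cmPrincipalSeries L 3 v (UnitaryGroup.cmTorusCharPair L v χ₁ χ₂)).IsIrreducible →
      π.IsConstituentOf (UnitaryGroup.cmPrincipalSeries L 3 v (UnitaryGroup.cmTorusCharPair L v χ₁ χ₂)) →
      ∀ γ ∈ 𝔇.ellG, 𝔇.char π γ = 0)
    (hLds2 : 𝔇.LdsCardTwo)
    -- ══ §2's inputs ══
    (hKeysRed : ∀ (χ₁ : (UnitaryGroup.LocalRing L v)ˣ →* ℂˣ) (χ₂ : ↥(normOneUnits (conjLocal L (IsCMField.complexConj L) v)) →* ℂˣ),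
      Continuous (fun x => ((χ₁ x : ℂˣ) : ℂ)) → Continuous (fun x => ((χ₂ x : ℂˣ) : ℂ)) →
      (∃ N : Subrepresentation (UnitaryGroup.cmPrincipalSeries L 3 v (UnitaryGroup.cmTorusCharPair L v χ₁ χ₂)), N ≠ ⊥ ∧ N ≠ ⊤) →
      (χ₁ = halfModulusChar (UnitaryGroup.LocalRing L v) * halfModulusChar (UnitaryGroup.LocalRing L v) ∨
          χ₁ = (halfModulusChar (UnitaryGroup.LocalRing L v) * halfModulusChar (UnitaryGroup.LocalRing L v))⁻¹) ∨
      (∃ η : (UnitaryGroup.LocalRing L v)ˣ →* ℂˣ, IsQuadraticCharExtension (conjLocal L (IsCMField.complexConj L) v) η ∧ Continuous (fun x => ((η x : ℂˣ) : ℂ)) ∧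
          (χ₁ = η * halfModulusChar (UnitaryGroup.LocalRing L v) ∨ χ₁ = η * (halfModulusChar (UnitaryGroup.LocalRing L v))⁻¹)) ∨
      (χ₁ ≠ 1 ∧ ∀ a : (UnitaryGroup.LocalRing L v)ˣ, (conjLocal L (IsCMField.complexConj L) v) (a : UnitaryGroup.LocalRing L v) = a → χ₁ a = 1))
    (hStJH : ∀ ψ₀ : ↥(normOneUnits (conjLocal L (IsCMField.complexConj L) v)) →* ℂˣ, Continuous (fun x => ((ψ₀ x : ℂˣ) : ℂ)) →
      ∃ ψ : ↥(Subgroup.center (Gqs L v)) →* ℂˣ, Continuous ψ ∧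
        ∀ c : IrrClass (Gqs L v),
          c.IsConstituentOf (UnitaryGroup.cmPrincipalSeries L 3 v
            (UnitaryGroup.cmTorusCharPair L v (halfModulusChar (UnitaryGroup.LocalRing L v) * halfModulusChar (UnitaryGroup.LocalRing L v))⁻¹ ψ₀)) ↔
            (c = 𝔇.stG ψ ∨ c = 𝔇.detG ψ))
    (hKeysJH : ∀ (η₁ η₂ : ↥(normOneUnits (conjLocal L (IsCMField.complexConj L) v)) →* ℂˣ),
      Continuous (fun x => ((η₁ x : ℂˣ) : ℂ)) → Continuous (fun x => ((η₂ x : ℂˣ) : ℂ)) →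
      ∃ ξ' : H →* ℂˣ, Continuous ξ' ∧ KeysCaseTwoLabels L v μv η₁ η₂ (𝔇.pi2 ξ') (𝔇.piN ξ'))
    (hLdsF : ∀ P : Finset (IrrClass (Gqs L v)), P ∈ 𝔇.ldsPackets ↔ (P.card = 2 ∧ ∃ (χ₁ : (UnitaryGroup.LocalRing L v)ˣ →* ℂˣ) (χ₂ : ↥(normOneUnits (conjLocal L (IsCMField.complexConj L) v)) →* ℂˣ), Continuous (fun x => ((χ₁ x : ℂˣ) : ℂ)) ∧ Continuous (fun x => ((χ₂ x : ℂˣ) : ℂ)) ∧ (∀ a : (UnitaryGroup.LocalRing L v)ˣ, (conjLocal L (IsCMField.complexConj L) v) (a : UnitaryGroup.LocalRing L v) = a → χ₁ a = 1) ∧ χ₁ ≠ 1 ∧ ∀ c : IrrClass (Gqs L v), c ∈ P ↔ c.IsConstituentOf (UnitaryGroup.cmPrincipalSeries L 3 v (UnitaryGroup.cmTorusCharPair L v χ₁ χ₂))))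
    (hLdsTwo : ∀ (χ₁ : (UnitaryGroup.LocalRing L v)ˣ →* ℂˣ) (χ₂ : ↥(normOneUnits (conjLocal L (IsCMField.complexConj L) v)) →* ℂˣ),
      Continuous (fun x => ((χ₁ x : ℂˣ) : ℂ)) → Continuous (fun x => ((χ₂ x : ℂˣ) : ℂ)) →
      (∀ a : (UnitaryGroup.LocalRing L v)ˣ, (conjLocal L (IsCMField.complexConj L) v) (a : UnitaryGroup.LocalRing L v) = a → χ₁ a = 1) → χ₁ ≠ 1 →
      ∃ P : Finset (IrrClass (Gqs L v)), P.card = 2 ∧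
        ∀ c : IrrClass (Gqs L v), c ∈ P ↔ c.IsConstituentOf (UnitaryGroup.cmPrincipalSeries L 3 v (UnitaryGroup.cmTorusCharPair L v χ₁ χ₂))) :
    Ch12Sec6.EllipticClassification 𝔇 :=
  F0P3cStCharTSEllClass.ellipticClassification_of_redJH L v hns 𝔇 hVan hLds2
    (redJH_of_keysRed L v hns 𝔇 μv hμv hμvc hKeysRed hStJH hKeysJH hLdsF hLdsTwo)

end Summit.HodgeConjecture.HodgeConjecture.Cruxes.H413.F0P3cStCharTSRedJH

end
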